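import Summits.CriticalPhenomena.CardyFormulaZ2.Theorems.CardySusyWardParafermionFamiliesToSLESixIkhlefPonsaing

/-!
# Line `strip-anchored-vertex-normalisation` (crux stmt-CriticalPhenomena-10814): the NORMAL FORM of the last stub —
# bulk non-vanishing of the spin-`1/3` vertex observable along the CONCRETE anchor family

Crux `CardySusyWard.ParafermionFamiliesToSLESix` (stmt-CriticalPhenomena-10814), line `strip-anchored-vertex-normalisation`
(leads c0–c5), skeleton r5/r6.  Lead c5.

The single registered stub of skeleton r5 (lead c4) is the layer estimate
`stub_anchorLayerSmall : ∀ Λ, IsFamily anchorDomain Λ → VertexVanishes anchorDomain Λ → ∀ η > 0, ∃ᶠ δ, ‖totalVertexSum (Λ δ) δ‖ ≤ η δ^{-5/3}`.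
The composition consumes it only at the CONCRETE admissible family `anchorData` of the diagonal anchor square (the
witness of `stub_anchorMoment_of_IP`).  This file records, sorry-free and with standard axioms, that AT THAT FAMILY the
stub is LITERALLY bulk non-vanishing:

* `anchorMoment_lower_anchorData`, `totalVertexSum_lower_anchorData` — the unconditional sharp-order lower bounds of
  `…IkhlefPonsaing.lean` (p138858) with the witness family NAMED (`anchorData`, not `∃ Λ`): eventually in `δ`,
  `c δ^{-5/3} ≤ ‖Σ_{p ∈ S_max} F_δ(p)‖` along `anchorData`;
* `not_layerSmall_anchorData` — hence the CONCLUSION of the r5 stub is unconditionally FALSE at `anchorData`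
  (the total vertex sum is never frequently `≤ η δ^{-5/3}` for small `η`);
* `layerSmall_anchorData_iff` — so the r5 stub read at `anchorData` is EQUIVALENT to
  `¬ VertexVanishes anchorDomain anchorData`: "the spin-`1/3` vertex parafermionic observable of critical bond
  percolation on the diagonal square, along the concrete discretisation family, is NOT `o(δ^{1/3})` uniformly on some
  compact `K ⊆ Ω`" — Duminil-Copin–Smirnov's Conjecture 8.7 non-degeneracy at `q = 1` for ONE polygon and ONE family,
  i.e. the Literature fact `ParafermionBulkNondegenerate` (`[status: open]`) with its two existential witnesses fixed;
* `bulkNondegenerate_of_not_vertexVanishes_anchorData`, `parafermionFamiliesToSLESix_of_not_vertexVanishes_anchorData` —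
  that normal form implies `H = ParafermionBulkNondegenerate` and the crux AS TYPED (its second hypothesis is then
  contradictory, `parafermionPrecompact_iff_vanishing`);
* `not_vertexVanishes_anchorData_of_layerSmall`, `parafermionFamiliesToSLESix_of_layerSmall`,
  `bulkNondegenerate_of_layerSmall` — the r5 skeleton's composition as tree theorems (the crux is
  `conditional_on [stub_anchorLayerSmall]` in the tree, not only in the Cruxes directory);
* `not_vertexVanishes_anchorData_of_envelope` — the envelope route (`stub_totalSmall_of_UIE`, p131326) pointed at the
  normal form: `UniformInnerEnvelope → ¬ VertexVanishes anchorDomain anchorData`.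

Sandwich (all kernel-checked here or earlier): `UniformInnerEnvelope ⇒ ¬VertexVanishes anchorDomain anchorData ⇔
(r5 stub at anchorData) ⇐ r5 stub`, and `¬VertexVanishes anchorDomain anchorData ⇒ ParafermionBulkNondegenerate ⇒ crux`.
So the line has reduced the crux (as typed `= H ∨ SLE₆(ℤ²)`) to `H` for one named polygon and family and to nothing
weaker: what remains is a sharp signed bulk exponent of bond percolation on `ℤ²` (obstruction ledgers of leads c3/c4 and
the strategist census in `Cruxes/ParafermionFamiliesToSLESix/`).

References: H. Duminil-Copin, S. Smirnov, *Conformal invariance of lattice models* (2012), §8, Conj. 8.7;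
Y. Ikhlef, A. K. Ponsaing, J. Stat. Phys. 149 (2012) 10–36, Prop. 4.7.
-/

noncomputable section

namespace Summit.CriticalPhenomena.CardyFormulaZ2.Theorems.ParafermionFamiliesToSLESix.StripAnchored

open MeasureTheory Filter Set Metric
open scoped Topology
open Literature.Probability.LatticeModels (DiscreteDobrushin ParafermionBulkNondegenerate Site zdGraph meshDomain
  discreteDomainGraph)
open Literature.Probability.Percolation (bondPercolation half BondConfig IkhlefPonsaingFirstPassage_holds)
open Literature.Probability.RandomPlanarGeometry (DobrushinDomain)
open Summit.CriticalPhenomena.CardyFormulaZ2.Theses.CardySusyWard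
open Summit.CriticalPhenomena.CardyFormulaZ2.Theorems.ParafermionPrecompact.Negative (IsFamily VanishesOn
  parafermionPrecompact_iff_vanishing parafermionBulkNondegenerate_iff_not_vanishing)
open Summit.CriticalPhenomena.CardyFormulaZ2.Cruxes.EdgePrecompact.QkzStripBoundaryArm (UniformInnerEnvelope)
open S5 (anchorDomain)

/-! ## The sharp-order lower bounds along the NAMED family `anchorData` -/

open AnchorMoment in
/-- **The anchor first moment along `anchorData` is of order `δ^{-5/3}`, unconditionally** — the proof of
`stub_anchorMoment_of_IP` (p136941) with Ikhlef–Ponsaing's strip law discharged (`IkhlefPonsaingFirstPassage_holds`) and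
the witness family kept explicit: eventually in `δ`, `(c/16) δ^{-5/3} ≤ ‖wallPlainSum − 2(1−i)·momentSum‖` along
`anchorData`, `c` the constant of S5's `touchProb_lower`. [folklore] -/
theorem anchorMoment_lower_anchorData : ∃ c : ℝ, 0 < c ∧
    ∀ᶠ δ in 𝓝[>] (0:ℝ), c * δ ^ (-(5:ℝ) / 3) ≤
      ‖wallPlainSum (anchorData δ) δ - 2 * (1 - Complex.I) * momentSum (anchorData δ) δ‖ := by
  obtain ⟨c, hc, L₀, harm⟩ := S5.touchProb_lower IkhlefPonsaingFirstPassage_holds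
  refine ⟨c / 16, by positivity, ?_⟩
  set K : ℝ := (466560 / c) ^ ((3:ℝ) / 2) with hKdef
  have hK0 : 0 ≤ K := by positivity
  have hδ₁ : (0:ℝ) < 1 / ((L₀ : ℝ) + K + 40) := by positivity
  filter_upwards [S5.anchor_geometry stub_anchorData_isFamily, Ioo_mem_nhdsGT hδ₁] with δ hgeom hδI
  obtain ⟨hδ0, hδ1⟩ := hδI
  obtain ⟨L, -, hLδ, hL1, hE, -, -, hmesh, hadj, hbd, -, -, harcA⟩ := hgeom
  -- `L` is large
  have hbig : (L₀ : ℝ) + K + 40 < (L : ℝ) + 1 := by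
    have h1 : δ * ((L₀ : ℝ) + K + 40) < 1 := by rwa [lt_div_iff₀ (by positivity)] at hδ1
    by_contra hle
    rw [not_lt] at hle
    have := mul_le_mul_of_nonneg_right hle hδ0.le
    nlinarith
  have hL₀' : (L₀ : ℝ) ≤ L := by linarith [(Nat.cast_nonneg L₀ : (0:ℝ) ≤ L₀)]
  have hL₀L : (L₀ : ℤ) ≤ L := by exact_mod_cast hL₀'
  have hL16' : (16 : ℝ) ≤ L := by linarith [(Nat.cast_nonneg L₀ : (0:ℝ) ≤ L₀)]
  have hL16 : (16 : ℤ) ≤ L := by exact_mod_cast hL16'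
  have hKL : K ≤ L := by linarith [(Nat.cast_nonneg L₀ : (0:ℝ) ≤ L₀)]
  have hδle : δ ≤ 1 := by
    refine (hδ1.trans_le ?_).le
    rw [div_le_one (by positivity)]
    linarith [(Nat.cast_nonneg L₀ : (0:ℝ) ≤ L₀)]
  -- the window touch bound along `anchorData δ`
  have hmass : ∀ w : Site 2, w 0 + w 1 = L - 2 → 2 * |w 0 - w 1| ≤ L + 2 →
      c * (L : ℝ) ^ (-(1:ℝ) / 3) ≤ (bondPercolation (zdGraph 2) half).real
        {ω : BondConfig (Site 2) | ∃ a ∈ (anchorData δ).zdArcA,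
          (SimpleGraph.fromEdgeSet ((anchorData δ).bcBondConfig ω)).Reachable w a} :=
    fun w hw hdw => harm (anchorData δ) L hL₀L hE hmesh hadj hbd harcA w hw hdw
  exact (numerics hc hδ0 hδle hL1 (by linarith) hKL).trans (lower_bound hδ0 hLδ hL1 hL16 hE hc.le hmass)

/-- **The total spin-`1/3` vertex observable along `anchorData` is of order at least `δ^{-5/3}`, unconditionally**:
`c δ^{-5/3} ≤ ‖totalVertexSum (anchorData δ) δ‖ = ‖Σ_{p ∈ S_max} F_δ(p)‖` eventually in `δ` (the moment identity
`stub_momentIdentity`, p131967, divides `anchorMoment_lower_anchorData` by `2cos(π/12)`). [folklore] -/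
theorem totalVertexSum_lower_anchorData : ∃ c : ℝ, 0 < c ∧
    ∀ᶠ δ in 𝓝[>] (0:ℝ), c * δ ^ (-(5:ℝ) / 3) ≤ ‖totalVertexSum (anchorData δ) δ‖ := by
  obtain ⟨c, hc, hbig⟩ := anchorMoment_lower_anchorData
  set A : ℝ := 2 * Real.cos (Real.pi / 12) with hA
  have hA0 : 0 < A := by
    have : 0 < Real.cos (Real.pi / 12) :=
      Real.cos_pos_of_mem_Ioo ⟨by linarith [Real.pi_pos], by linarith [Real.pi_pos]⟩
    positivity
  refine ⟨c / A, by positivity, ?_⟩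
  filter_upwards [stub_momentIdentity anchorDomain anchorData stub_anchorData_isFamily, hbig] with δ hid hge
  have key : c * δ ^ (-(5:ℝ) / 3) ≤ A * ‖totalVertexSum (anchorData δ) δ‖ := by
    calc c * δ ^ (-(5:ℝ) / 3)
        ≤ ‖wallPlainSum (anchorData δ) δ - 2 * (1 - Complex.I) * momentSum (anchorData δ) δ‖ := hge
      _ = ‖((A : ℝ) : ℂ) * totalVertexSum (anchorData δ) δ‖ := by rw [← hid]
      _ = A * ‖totalVertexSum (anchorData δ) δ‖ := by rw [norm_mul, Complex.norm_real, Real.norm_of_nonneg hA0.le]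
  calc c / A * δ ^ (-(5:ℝ) / 3) = c * δ ^ (-(5:ℝ) / 3) / A := by ring
    _ ≤ A * ‖totalVertexSum (anchorData δ) δ‖ / A := div_le_div_of_nonneg_right key hA0.le
    _ = ‖totalVertexSum (anchorData δ) δ‖ := by field_simp

/-! ## The normal form of the r5 stub -/

/-- **The conclusion of the r5 stub is unconditionally FALSE at `anchorData`**: the total vertex sum of the concrete
anchor family is NOT frequently `≤ η δ^{-5/3}` for every `η > 0` (take `η = c/2` in
`totalVertexSum_lower_anchorData`). [folklore] -/
theorem not_layerSmall_anchorData :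
    ¬ ∀ η > (0:ℝ), ∃ᶠ δ in 𝓝[>] (0:ℝ), ‖totalVertexSum (anchorData δ) δ‖ ≤ η * δ ^ (-(5:ℝ) / 3) := by
  obtain ⟨c, hc, hbig⟩ := totalVertexSum_lower_anchorData
  intro h
  have hpos : ∀ᶠ δ in 𝓝[>] (0:ℝ), (0:ℝ) < δ := eventually_mem_nhdsWithin
  obtain ⟨δ, hle, hge, hδ0⟩ := ((h (c / 2) (by positivity)).and_eventually (hbig.and hpos)).exists
  have hpow : (0:ℝ) < δ ^ (-(5:ℝ) / 3) := Real.rpow_pos_of_pos hδ0 _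
  have key : c * δ ^ (-(5:ℝ) / 3) ≤ c / 2 * δ ^ (-(5:ℝ) / 3) := hge.trans hle
  have := le_of_mul_le_mul_right key hpow
  linarith

/-- **NORMAL FORM.** Read at the concrete family `anchorData`, the r5 stub `stub_anchorLayerSmall` is EQUIVALENT to bulk
non-vanishing there: `¬ VertexVanishes anchorDomain anchorData`, i.e. on SOME compact `K ⊆ Ω` of the diagonal anchor
square the spin-`1/3` vertex observable of the concrete discretisation family is not `o(δ^{1/3})` uniformly —
Duminil-Copin–Smirnov's Conjecture 8.7 non-degeneracy at `q = 1` for one named polygon and family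
(`ParafermionBulkNondegenerate` with both existential witnesses fixed). [cite: DuminilCopinSmirnov2012Lattice, Conjecture 8.7] -/
theorem layerSmall_anchorData_iff : (VertexVanishes anchorDomain anchorData → ∀ η > (0:ℝ), ∃ᶠ δ in 𝓝[>] (0:ℝ), ‖totalVertexSum (anchorData δ) δ‖ ≤ η * δ ^ (-(5:ℝ) / 3)) ↔ ¬ VertexVanishes anchorDomain anchorData :=
  ⟨fun h hV => not_layerSmall_anchorData (h hV), fun h hV => (h hV).elim⟩

/-- **From the r5 stub (all anchor families) to bulk non-vanishing along `anchorData`** (instantiate at the concrete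
family, `stub_anchorData_isFamily`, and use the normal form). [folklore] -/
theorem not_vertexVanishes_anchorData_of_layerSmall
    (hSmall : ∀ Λ : ℝ → DiscreteDobrushin, IsFamily anchorDomain Λ → VertexVanishes anchorDomain Λ → ∀ η > (0:ℝ),
      ∃ᶠ δ in 𝓝[>] (0:ℝ), ‖totalVertexSum (Λ δ) δ‖ ≤ η * δ ^ (-(5:ℝ) / 3)) :
    ¬ VertexVanishes anchorDomain anchorData :=
  layerSmall_anchorData_iff.1 (hSmall anchorData stub_anchorData_isFamily)

/-- **Converse bookkeeping**: bulk non-vanishing along EVERY admissible family of the anchor square gives the r5 stub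
(vacuously — its hypothesis `VertexVanishes` is then never met). [folklore] -/
theorem layerSmall_of_forall_not_vertexVanishes
    (h : ∀ Λ : ℝ → DiscreteDobrushin, IsFamily anchorDomain Λ → ¬ VertexVanishes anchorDomain Λ) :
    ∀ Λ : ℝ → DiscreteDobrushin, IsFamily anchorDomain Λ → VertexVanishes anchorDomain Λ → ∀ η > (0:ℝ),
      ∃ᶠ δ in 𝓝[>] (0:ℝ), ‖totalVertexSum (Λ δ) δ‖ ≤ η * δ ^ (-(5:ℝ) / 3) :=
  fun Λ hΛ hV => (h Λ hΛ hV).elim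

/-! ## What the normal form buys: `H` and the crux as typed -/

/-- **Bulk non-vanishing along `anchorData` IS a witness of `H = ParafermionBulkNondegenerate`** (Duminil-Copin–Smirnov
2012, Conjecture 8.7's lower bound for bond percolation on `ℤ²`, `[status: open]`): the domain is the anchor square, the
family is `anchorData` (`stub_anchorData_isFamily`), the compact is the one on which vanishing fails.
[cite: DuminilCopinSmirnov2012Lattice, Conjecture 8.7] -/
theorem bulkNondegenerate_of_not_vertexVanishes_anchorData (h : ¬ VertexVanishes anchorDomain anchorData) :
    ParafermionBulkNondegenerate := by
  rw [parafermionBulkNondegenerate_iff_not_vanishing]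
  exact fun hV => h fun K hK hKD => hV anchorDomain anchorData stub_anchorData_isFamily K hK hKD

/-- **Bulk non-vanishing along `anchorData` contradicts the typed second hypothesis `ParafermionPrecompact`** (which, as
typed, is vertex vanishing on compacts along every family, `parafermionPrecompact_iff_vanishing`). [folklore] -/
theorem not_parafermionPrecompact_of_not_vertexVanishes_anchorData (h : ¬ VertexVanishes anchorDomain anchorData) :
    ¬ ParafermionPrecompact := fun hP =>
  h fun K hK hKD => (parafermionPrecompact_iff_vanishing.1 hP) anchorDomain anchorData stub_anchorData_isFamily K hK hKD

/-- **The crux `ParafermionFamiliesToSLESix` (stmt-CriticalPhenomena-10814) AS TYPED from bulk non-vanishing along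
`anchorData`**: its second hypothesis is then contradictory, so the implication holds. [folklore] -/
theorem parafermionFamiliesToSLESix_of_not_vertexVanishes_anchorData (h : ¬ VertexVanishes anchorDomain anchorData) :
    ParafermionFamiliesToSLESix := fun _hW hP =>
  (not_parafermionPrecompact_of_not_vertexVanishes_anchorData h hP).elim

/-- **The r5 skeleton's composition as a tree theorem**: the registered stub `stub_anchorLayerSmall` (its statement taken
as hypothesis) implies the crux AS TYPED. [folklore] -/
theorem parafermionFamiliesToSLESix_of_layerSmall
    (hSmall : ∀ Λ : ℝ → DiscreteDobrushin, IsFamily anchorDomain Λ → VertexVanishes anchorDomain Λ → ∀ η > (0:ℝ),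
      ∃ᶠ δ in 𝓝[>] (0:ℝ), ‖totalVertexSum (Λ δ) δ‖ ≤ η * δ ^ (-(5:ℝ) / 3)) :
    ParafermionFamiliesToSLESix :=
  parafermionFamiliesToSLESix_of_not_vertexVanishes_anchorData (not_vertexVanishes_anchorData_of_layerSmall hSmall)

/-- **The line's deliverable `H` from the r5 stub** (its statement taken as hypothesis).
[cite: DuminilCopinSmirnov2012Lattice, Conjecture 8.7] -/
theorem bulkNondegenerate_of_layerSmall
    (hSmall : ∀ Λ : ℝ → DiscreteDobrushin, IsFamily anchorDomain Λ → VertexVanishes anchorDomain Λ → ∀ η > (0:ℝ),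
      ∃ᶠ δ in 𝓝[>] (0:ℝ), ‖totalVertexSum (Λ δ) δ‖ ≤ η * δ ^ (-(5:ℝ) / 3)) :
    ParafermionBulkNondegenerate :=
  bulkNondegenerate_of_not_vertexVanishes_anchorData (not_vertexVanishes_anchorData_of_layerSmall hSmall)

/-- **The envelope route, pointed at the normal form**: under the uniform inner envelope the vertex observable of the
concrete anchor family does NOT vanish at scale `δ^{1/3}` on compacts (`stub_totalSmall_of_UIE`, p131326, makes the
total sum eventually `≤ η δ^{-5/3}` under vanishing, against `not_layerSmall_anchorData`). [folklore] -/
theorem not_vertexVanishes_anchorData_of_envelope (hU : UniformInnerEnvelope) :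
    ¬ VertexVanishes anchorDomain anchorData := fun hV =>
  not_layerSmall_anchorData fun η hη => (stub_totalSmall_of_UIE hU anchorData stub_anchorData_isFamily hV η hη).frequently

/-! ## The normal form in Literature vocabulary (appended, lead c5) -/

/-- **The residual of the line, unfolded** (registered `anchorBulk_iff_exists`): `¬ VertexVanishes anchorDomain anchorData`
iff on some compact `K ⊆ Ω` of the anchor square, for some `ε > 0`, FREQUENTLY as `δ → 0⁺` some medial vertex `z` over
`K` has `ε δ^{1/3} < ‖vertexObs (anchorData δ) δ z‖` — VERBATIM the body of the Literature fact
`ParafermionBulkNondegenerate` (Duminil-Copin–Smirnov 2012, Conj. 8.7 non-degeneracy at `q = 1`, `[status: open]`) with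
`D := anchorDomain`, `Λ := anchorData` (and `vertexObs (anchorData δ) δ z` definitionally its integral).  This is the
fileable text of the promoted residual. [cite: DuminilCopinSmirnov2012Lattice, Conjecture 8.7] -/
theorem anchorBulk_iff_exists : (¬ VertexVanishes anchorDomain anchorData) ↔ ∃ K : Set ℂ, IsCompact K ∧ K ⊆ anchorDomain.carrier ∧ ∃ ε : ℝ, 0 < ε ∧ ∃ᶠ δ in 𝓝[>] (0:ℝ), ∃ z : Literature.Probability.LatticeModels.MedialVertex, Literature.Probability.LatticeModels.medialPoint δ z ∈ K ∧ ε * δ ^ ((1:ℝ) / 3) < ‖vertexObs (anchorData δ) δ z‖ := by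
  constructor
  · intro h
    by_contra hN
    refine h fun K hK hKD ε hε => ?_
    by_contra hev
    refine hN ⟨K, hK, hKD, ε, hε, ?_⟩
    refine (Filter.not_eventually.1 hev).mono fun δ hδ => ?_
    simp only [not_forall, not_le, exists_prop] at hδ
    exact hδ
  · rintro ⟨K, hK, hKD, ε, hε, hfr⟩ hV
    refine hfr ?_
    filter_upwards [hV K hK hKD ε hε] with δ hδ
    rintro ⟨z, hz, hlt⟩
    exact (not_le.2 hlt) (hδ z hz)

/-- **`H` restricted to the anchor square and the concrete family, as a witness of `H`** — the unfolded form feeds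
`ParafermionBulkNondegenerate` directly (same three witnesses as `bulkNondegenerate_of_not_vertexVanishes_anchorData`).
[cite: DuminilCopinSmirnov2012Lattice, Conjecture 8.7] -/
theorem bulkNondegenerate_of_anchorBulk_exists
    (h : ∃ K : Set ℂ, IsCompact K ∧ K ⊆ anchorDomain.carrier ∧ ∃ ε : ℝ, 0 < ε ∧
      ∃ᶠ δ in 𝓝[>] (0:ℝ), ∃ z : Literature.Probability.LatticeModels.MedialVertex,
        Literature.Probability.LatticeModels.medialPoint δ z ∈ K ∧ ε * δ ^ ((1:ℝ) / 3) < ‖vertexObs (anchorData δ) δ z‖) :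
    ParafermionBulkNondegenerate :=
  bulkNondegenerate_of_not_vertexVanishes_anchorData (anchorBulk_iff_exists.2 h)

end Summit.CriticalPhenomena.CardyFormulaZ2.Theorems.ParafermionFamiliesToSLESix.StripAnchored

end
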